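import Summits.RiemannHypothesis.RiemannHypothesis.Theses.RuelleBand
import Literature.NumberTheory.LFunctions.RHWave0HardyProofs
import Literature.NumberTheory.LFunctions.GeneralizedRH

/-!
# `AsymptoticCriticalLine` (crux `stmt-RiemannHypothesis-2063`, route `RuelleBand`):
# load-bearing clauses and equivalent forms (negative-side support)

Support file of the crux disprover (cdisprove seat refuter-cdisprove-stmt-RiemannHypothesis-2063-0).
The crux is `∀ ε > 0, {s | ζ s = 0 ∧ 0 < Re s ∧ Re s < 1 ∧ ε ≤ |Re s − 1/2|}.Finite`; writing
`bandSet Z ε` for that set with `Z` in place of `ζ`, everything below is proved `sorry`-free: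

* read-back and kill shape: `acl_iff_bandSet` (`Iff.rfl`), `not_acl_iff`; the parameter has content
  only for `0 < ε < 1/2` (`bandSet_eq_empty_of_half_le`, `bandSet_antitone`, `acl_iff_small`,
  `acl_iff_nat`);
* LOAD-BEARING clauses: dropping `0 < Re s` (`acl_false_without_rePos`, trivial zeros; also
  `acl_false_without_strip`), `0 < ε` (`acl_false_without_epsPos`, Hardy's theorem from the tree) or
  `ζ s = 0` (`acl_false_without_zero`) makes the statement FALSE; `Re s < 1` is REDUNDANT
  (`acl_iff_without_reLtOne`);
* NO PARTIAL CREDIT: one finite band of level `ε < 1/2` is an eventual quasi-RH on `Re s ≥ 1/2 + ε`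
  (`eventually_zeroFree_of_bandSet_finite`) — each single instance of the crux is open;
* EQUIVALENT FORMS: one-sided (`acl_iff_rightBand`), bounded height (`bandSet_finite_iff_bounded`,
  `acl_iff_height`), Mathlib's non-trivial-zero convention (`acl_iff_nontrivial`), and rung #5 as the
  union of all bands (`cofinite_iff_iUnion_bandSet`); RH empties every band
  (`bandSet_eq_empty_of_riemannHypothesis`) — a refutation of the crux is a disproof of RH.

The companion file `ShapeFails.lean` shows that the band SHAPE fails for `ζ`-like objects.
-/


noncomputable section

namespace Summit.RiemannHypothesis.RiemannHypothesis.Theorems.AsymptoticCriticalLine.Negative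

open Complex Set
open Summit.RiemannHypothesis.RiemannHypothesis.Theses.RuelleBand
  (AsymptoticCriticalLine CofiniteCriticalLine)

/-! ## 0. Read-back: the band sets -/

/-- The *band set* of a function `Z` at level `ε`: zeros of `Z` in the open critical strip at
distance `≥ ε` from the critical line. [folklore] -/
def bandSet (Z : ℂ → ℂ) (ε : ℝ) : Set ℂ :=
  {s : ℂ | Z s = 0 ∧ 0 < s.re ∧ s.re < 1 ∧ ε ≤ |s.re - 1 / 2|}

/-- The crux is literally "every band set of `riemannZeta` of positive level is finite". [folklore] -/
theorem acl_iff_bandSet :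
    AsymptoticCriticalLine ↔ ∀ ε : ℝ, 0 < ε → (bandSet riemannZeta ε).Finite := Iff.rfl

/-- KILL SHAPE. The crux fails iff a "second band" exists: some level `ε > 0` carries infinitely
many zeros. [folklore] -/
theorem not_acl_iff :
    ¬ AsymptoticCriticalLine ↔ ∃ ε : ℝ, 0 < ε ∧ (bandSet riemannZeta ε).Infinite := by
  rw [acl_iff_bandSet]
  constructor
  · intro h
    by_contra h'
    push Not at h'
    exact h h'
  · rintro ⟨ε, hε, hinf⟩ h
    exact hinf (h ε hε)

/-! ## 1. Boundary of the parameter: content only for `0 < ε < 1/2` -/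

/-- For `ε ≥ 1/2` every band set is EMPTY (points of the open strip are at distance `< 1/2` from
the line): the crux is vacuous there. [folklore] -/
theorem bandSet_eq_empty_of_half_le (Z : ℂ → ℂ) {ε : ℝ} (hε : 1 / 2 ≤ ε) : bandSet Z ε = ∅ := by
  ext s
  simp only [bandSet, mem_setOf_eq, mem_empty_iff_false, iff_false, not_and]
  intro _ h0 h1 h
  rcases le_abs.1 h with h' | h' <;> linarith

/-- Band sets decrease in the level. [folklore] -/
theorem bandSet_antitone (Z : ℂ → ℂ) {ε ε' : ℝ} (h : ε ≤ ε') : bandSet Z ε' ⊆ bandSet Z ε := by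
  rintro s ⟨hz, h0, h1, hε⟩
  exact ⟨hz, h0, h1, h.trans hε⟩

/-- Hence the crux only needs levels `0 < ε < 1/2` … [folklore] -/
theorem acl_iff_small :
    AsymptoticCriticalLine ↔ ∀ ε : ℝ, 0 < ε → ε < 1 / 2 → (bandSet riemannZeta ε).Finite := by
  rw [acl_iff_bandSet]
  refine ⟨fun h ε hε _ => h ε hε, fun h ε hε => ?_⟩
  by_cases hlt : ε < 1 / 2
  · exact h ε hε hlt
  · rw [bandSet_eq_empty_of_half_le _ (not_lt.1 hlt)]
    exact finite_empty

/-- … or the levels `1/(n+1)`. [folklore] -/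
theorem acl_iff_nat :
    AsymptoticCriticalLine ↔ ∀ n : ℕ, (bandSet riemannZeta (1 / ((n : ℝ) + 1))).Finite := by
  rw [acl_iff_bandSet]
  refine ⟨fun h n => h _ (by positivity), fun h ε hε => ?_⟩
  obtain ⟨n, hn⟩ := exists_nat_one_div_lt hε
  exact (h n).subset (bandSet_antitone _ hn.le)

/-! ## 2. Load-bearing clauses: drop one at a time -/

/-- Real part of the trivial zero `-2(n+1)`. [folklore] -/
theorem trivialZero_re (n : ℕ) : (-2 * ((n : ℂ) + 1)).re = -2 * ((n : ℝ) + 1) := by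
  have : (-2 * ((n : ℂ) + 1)) = ((-2 * ((n : ℝ) + 1) : ℝ) : ℂ) := by push_cast; ring
  rw [this, ofReal_re]

/-- `0 < s.re` is LOAD-BEARING: without it the trivial zeros `-2, -4, -6, …` form an infinite band
at every level (witness level `ε = 1`). [folklore] -/
theorem acl_false_without_rePos :
    ¬ ∀ ε : ℝ, 0 < ε → {s : ℂ | riemannZeta s = 0 ∧ s.re < 1 ∧ ε ≤ |s.re - 1 / 2|}.Finite := by
  intro h
  have hfin := h 1 one_pos
  have hsub : Set.range (fun n : ℕ => (-2 * ((n : ℂ) + 1)))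
      ⊆ {s : ℂ | riemannZeta s = 0 ∧ s.re < 1 ∧ 1 ≤ |s.re - 1 / 2|} := by
    rintro _ ⟨n, rfl⟩
    refine ⟨riemannZeta_neg_two_mul_nat_add_one n, ?_, ?_⟩
    · rw [trivialZero_re]
      have : (0 : ℝ) ≤ n := n.cast_nonneg
      linarith
    · rw [trivialZero_re]
      have : (0 : ℝ) ≤ n := n.cast_nonneg
      rw [abs_of_neg (by linarith)]
      linarith
  have hinj : Function.Injective (fun n : ℕ => (-2 * ((n : ℂ) + 1))) := by
    intro a b hab
    have h' := congrArg Complex.re hab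
    simp only [trivialZero_re] at h'
    exact_mod_cast (by linarith : (a : ℝ) = b)
  exact (Set.infinite_range_of_injective hinj).mono hsub hfin

/-- With BOTH strip clauses dropped the statement is false as well (same witness). [folklore] -/
theorem acl_false_without_strip :
    ¬ ∀ ε : ℝ, 0 < ε → {s : ℂ | riemannZeta s = 0 ∧ ε ≤ |s.re - 1 / 2|}.Finite := fun h =>
  acl_false_without_rePos fun ε hε => (h ε hε).subset fun _ ⟨hz, _, hε'⟩ => ⟨hz, hε'⟩

/-- The point `1/2 + it` of the critical line. [folklore] -/
theorem critPt_re (t : ℝ) : ((1 : ℂ) / 2 + t * I).re = 1 / 2 := by simp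

/-- [folklore] -/
theorem critPt_im (t : ℝ) : ((1 : ℂ) / 2 + t * I).im = t := by simp

/-- `0 < ε` is LOAD-BEARING: at level `ε = 0` the band set contains every critical zero, and there
are infinitely many of those (Hardy 1914, PROVED in tree:
`Literature.NumberTheory.LFunctions.hardy_infinite_zeros_on_critical_line_holds`). [folklore] -/
theorem acl_false_without_epsPos :
    ¬ ∀ ε : ℝ, {s : ℂ | riemannZeta s = 0 ∧ 0 < s.re ∧ s.re < 1 ∧ ε ≤ |s.re - 1 / 2|}.Finite := by
  intro h
  have hfin : (bandSet riemannZeta 0).Finite := h 0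
  have hH : {t : ℝ | riemannZeta (1 / 2 + t * I) = 0}.Infinite :=
    Literature.NumberTheory.LFunctions.hardy_infinite_zeros_on_critical_line_holds
  have hsub : (fun t : ℝ => (1 : ℂ) / 2 + t * I) '' {t : ℝ | riemannZeta (1 / 2 + t * I) = 0}
      ⊆ bandSet riemannZeta 0 := by
    rintro _ ⟨t, ht, rfl⟩
    refine ⟨ht, ?_, ?_, ?_⟩
    · rw [critPt_re]; norm_num
    · rw [critPt_re]; norm_num
    · rw [critPt_re]; norm_num
  have hinj : Set.InjOn (fun t : ℝ => (1 : ℂ) / 2 + t * I)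
      {t : ℝ | riemannZeta (1 / 2 + t * I) = 0} := by
    intro a _ b _ hab
    have h' := congrArg Complex.im hab
    simpa only [critPt_im] using h'
  exact (hH.image hinj).mono hsub hfin

/-- `riemannZeta s = 0` is (trivially) LOAD-BEARING: the line `Re s = 3/4` lies in the
level-`1/4` region. [folklore] -/
theorem acl_false_without_zero :
    ¬ ∀ ε : ℝ, 0 < ε → {s : ℂ | 0 < s.re ∧ s.re < 1 ∧ ε ≤ |s.re - 1 / 2|}.Finite := by
  intro h
  have hfin := h (1 / 4) (by norm_num)
  have hsub : Set.range (fun t : ℝ => (((3 : ℝ) / 4 : ℝ) : ℂ) + t * I)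
      ⊆ {s : ℂ | 0 < s.re ∧ s.re < 1 ∧ 1 / 4 ≤ |s.re - 1 / 2|} := by
    rintro _ ⟨t, rfl⟩
    simp only [mem_setOf_eq, add_re, ofReal_re, mul_re, I_re, mul_zero, ofReal_im, I_im, mul_one,
      sub_self, add_zero]
    norm_num [abs_of_pos]
  have hinj : Function.Injective (fun t : ℝ => (((3 : ℝ) / 4 : ℝ) : ℂ) + t * I) := by
    intro a b hab
    have h' := congrArg Complex.im hab
    simpa using h'
  exact (Set.infinite_range_of_injective hinj).mono hsub hfin

/-- `s.re < 1` is REDUNDANT: a zero with `0 < Re s` has `Re s < 1` automatically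
(Hadamard–de la Vallée Poussin, Mathlib `riemannZeta_ne_zero_of_one_le_re`). [folklore] -/
theorem setOf_withoutReLtOne_eq (ε : ℝ) :
    {s : ℂ | riemannZeta s = 0 ∧ 0 < s.re ∧ ε ≤ |s.re - 1 / 2|} = bandSet riemannZeta ε := by
  ext s
  simp only [bandSet, mem_setOf_eq]
  constructor
  · rintro ⟨hz, h0, hε⟩
    refine ⟨hz, h0, ?_, hε⟩
    by_contra h1
    exact riemannZeta_ne_zero_of_one_le_re (not_lt.1 h1) hz
  · rintro ⟨hz, h0, _, hε⟩
    exact ⟨hz, h0, hε⟩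

/-- Information for the prover: the clause `s.re < 1` may be dropped (or kept) freely. [folklore] -/
theorem acl_iff_without_reLtOne :
    AsymptoticCriticalLine ↔
      ∀ ε : ℝ, 0 < ε → {s : ℂ | riemannZeta s = 0 ∧ 0 < s.re ∧ ε ≤ |s.re - 1 / 2|}.Finite := by
  simp only [acl_iff_bandSet, setOf_withoutReLtOne_eq]

/-! ## 3. Equivalent forms -/

/-- The RIGHT half-band at level `ε`: zeros with `1/2 + ε ≤ Re s < 1`. [folklore] -/
def rightBandSet (ε : ℝ) : Set ℂ :=
  {s : ℂ | riemannZeta s = 0 ∧ 1 / 2 + ε ≤ s.re ∧ s.re < 1}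

/-- The right half-band sits inside the band (for `ε > 0`). [folklore] -/
theorem rightBandSet_subset_bandSet {ε : ℝ} (hε : 0 < ε) :
    rightBandSet ε ⊆ bandSet riemannZeta ε := by
  rintro s ⟨hz, hre, h1⟩
  refine ⟨hz, by linarith, h1, ?_⟩
  rw [abs_of_pos (by linarith)]
  linarith

/-- The band is covered by the right half-band and its reflection `s ↦ 1 - s` (functional
equation, tree `GeneralizedRH.riemannZeta_one_sub_eq_zero`). [folklore] -/
theorem bandSet_subset_union (ε : ℝ) :
    bandSet riemannZeta ε ⊆ rightBandSet ε ∪ (fun s => 1 - s) '' rightBandSet ε := by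
  rintro s ⟨hz, h0, h1, hε⟩
  rcases le_or_gt 0 (s.re - 1 / 2) with h | h
  · left
    rw [abs_of_nonneg h] at hε
    exact ⟨hz, by linarith, h1⟩
  · right
    rw [abs_of_neg h] at hε
    refine ⟨1 - s, ⟨Literature.NumberTheory.LFunctions.GeneralizedRH.riemannZeta_one_sub_eq_zero
      hz h0 h1, ?_, ?_⟩, by ring⟩
    · simp only [sub_re, one_re]; linarith
    · simp only [sub_re, one_re]; linarith

/-- ONE-SIDED FORM: by the symmetry `ρ ↦ 1 - ρ` of the zero set, the crux is equivalent to
finiteness of the RIGHT half-bands only. [folklore] -/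
theorem acl_iff_rightBand :
    AsymptoticCriticalLine ↔ ∀ ε : ℝ, 0 < ε → (rightBandSet ε).Finite := by
  rw [acl_iff_bandSet]
  refine ⟨fun h ε hε => (h ε hε).subset (rightBandSet_subset_bandSet hε), fun h ε hε => ?_⟩
  exact ((h ε hε).union ((h ε hε).image _)).subset (bandSet_subset_union ε)

/-- Band sets are bounded in height iff finite: the zeros of `ζ` in a compact set are finite
(Mathlib `IsCompact.inter_riemannZetaZeros_finite`). [folklore] -/
theorem bandSet_finite_iff_bounded (ε : ℝ) :
    (bandSet riemannZeta ε).Finite ↔ ∃ T : ℝ, ∀ s ∈ bandSet riemannZeta ε, |s.im| ≤ T := by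
  constructor
  · intro h
    obtain ⟨T, hT⟩ := (h.image fun s : ℂ => |s.im|).bddAbove
    exact ⟨T, fun s hs => hT ⟨s, hs, rfl⟩⟩
  · rintro ⟨T, hT⟩
    refine (((isCompact_Icc (a := (0 : ℝ)) (b := 1)).reProdIm
      (isCompact_Icc (a := -T) (b := T))).inter_riemannZetaZeros_finite).subset ?_
    intro s hs
    have hs' := hs
    obtain ⟨hz, h0, h1, _⟩ := hs'
    exact ⟨Complex.mem_reProdIm.2 ⟨⟨h0.le, h1.le⟩, abs_le.1 (hT s hs)⟩, hz⟩

/-- NO PARTIAL CREDIT: finiteness of ONE band of level `ε < 1/2` is already an eventual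
quasi-Riemann hypothesis — `ζ ≠ 0` on `Re s ≥ 1/2 + ε`, `|Im s| > T(ε)` — beyond every zero-free
region in print (all of width `→ 0` as `|t| → ∞`); so each single instance of the crux is open.
[folklore] -/
theorem eventually_zeroFree_of_bandSet_finite {ε : ℝ} (hε : 0 < ε)
    (h : (bandSet riemannZeta ε).Finite) :
    ∃ T : ℝ, ∀ s : ℂ, 1 / 2 + ε ≤ s.re → T < |s.im| → riemannZeta s ≠ 0 := by
  obtain ⟨T, hT⟩ := (bandSet_finite_iff_bounded ε).1 h
  refine ⟨T, fun s hre him hz => ?_⟩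
  have h1 : s.re < 1 := by
    by_contra h1
    exact riemannZeta_ne_zero_of_one_le_re (not_lt.1 h1) hz
  have hs : s ∈ bandSet riemannZeta ε :=
    ⟨hz, by linarith, h1, by rw [abs_of_pos (by linarith)]; linarith⟩
  exact (lt_irrefl T) (him.trans_le (hT s hs))

/-- HEIGHT FORM ("`Θ_ess = 1/2`" as usually printed): for every `ε > 0` there is a height
`T(ε)` above which every zero of the open strip lies within `ε` of the critical line. [folklore] -/
theorem acl_iff_height :
    AsymptoticCriticalLine ↔
      ∀ ε : ℝ, 0 < ε → ∃ T : ℝ, ∀ s : ℂ, riemannZeta s = 0 → 0 < s.re → s.re < 1 →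
        T < |s.im| → |s.re - 1 / 2| < ε := by
  rw [acl_iff_bandSet]
  refine forall₂_congr fun ε _ => ?_
  rw [bandSet_finite_iff_bounded]
  refine exists_congr fun T => ⟨fun h s hz h0 h1 hT => ?_, fun h s hs => ?_⟩
  · by_contra hε
    exact (lt_irrefl T) (hT.trans_le (h s ⟨hz, h0, h1, not_lt.1 hε⟩))
  · obtain ⟨hz, h0, h1, hε⟩ := hs
    by_contra hT
    exact (lt_irrefl ε) (hε.trans_lt (h s hz h0 h1 (not_le.1 hT)))

/-- NON-TRIVIAL-ZERO FORM: with Mathlib's convention (`RiemannHypothesis` quantifies over zeros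
that are not `-2(n+1)`), the strip clauses can be traded for "non-trivial"
(tree `riemannZeta_eq_zero_iff_of_re_nonpos` and Mathlib `riemannZeta_ne_zero_of_one_le_re`).
[folklore] -/
theorem acl_iff_nontrivial :
    AsymptoticCriticalLine ↔
      ∀ ε : ℝ, 0 < ε →
        {s : ℂ | riemannZeta s = 0 ∧ (¬ ∃ n : ℕ, s = -2 * (n + 1)) ∧ ε ≤ |s.re - 1 / 2|}.Finite := by
  rw [acl_iff_bandSet]
  refine forall₂_congr fun ε _ => ?_
  have hset : {s : ℂ | riemannZeta s = 0 ∧ (¬ ∃ n : ℕ, s = -2 * (n + 1)) ∧ ε ≤ |s.re - 1 / 2|}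
      = bandSet riemannZeta ε := by
    ext s
    simp only [bandSet, mem_setOf_eq]
    constructor
    · rintro ⟨hz, hnt, hε⟩
      refine ⟨hz, ?_, ?_, hε⟩
      · by_contra h0
        exact hnt ((Literature.NumberTheory.LFunctions.riemannZeta_eq_zero_iff_of_re_nonpos
          (not_lt.1 h0)).1 hz)
      · by_contra h1
        exact riemannZeta_ne_zero_of_one_le_re (not_lt.1 h1) hz
    · rintro ⟨hz, h0, _, hε⟩
      refine ⟨hz, ?_, hε⟩
      rintro ⟨n, rfl⟩
      rw [trivialZero_re] at h0
      have : (0 : ℝ) ≤ n := n.cast_nonneg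
      linarith
  rw [hset]

/-- RUNG #5 in band language: `CofiniteCriticalLine` is the finiteness of the union of all
positive-level bands. [folklore] -/
theorem cofinite_iff_iUnion_bandSet :
    CofiniteCriticalLine ↔ (⋃ n : ℕ, bandSet riemannZeta (1 / ((n : ℝ) + 1))).Finite := by
  have hset : {s : ℂ | riemannZeta s = 0 ∧ 0 < s.re ∧ s.re < 1 ∧ s.re ≠ 1 / 2}
      = ⋃ n : ℕ, bandSet riemannZeta (1 / ((n : ℝ) + 1)) := by
    ext s
    simp only [mem_setOf_eq, mem_iUnion, bandSet]
    constructor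
    · rintro ⟨hz, h0, h1, hne⟩
      have hpos : 0 < |s.re - 1 / 2| := abs_pos.2 (sub_ne_zero.2 hne)
      obtain ⟨n, hn⟩ := exists_nat_one_div_lt hpos
      exact ⟨n, hz, h0, h1, hn.le⟩
    · rintro ⟨n, hz, h0, h1, hn⟩
      refine ⟨hz, h0, h1, fun h => ?_⟩
      rw [h, sub_self, abs_zero] at hn
      have : (0 : ℝ) < 1 / ((n : ℝ) + 1) := by positivity
      linarith
  unfold CofiniteCriticalLine
  rw [hset]

/-! ## 4. Calibration: RH empties every band (a kill of the crux is a disproof of RH) -/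

/-- Under Mathlib's `RiemannHypothesis` every band set of positive level is EMPTY. [folklore] -/
theorem bandSet_eq_empty_of_riemannHypothesis (hRH : RiemannHypothesis) {ε : ℝ} (hε : 0 < ε) :
    bandSet riemannZeta ε = ∅ := by
  ext s
  simp only [bandSet, mem_setOf_eq, mem_empty_iff_false, iff_false, not_and]
  intro hz h0 h1 hε'
  have hnt : ¬ ∃ n : ℕ, s = -2 * (n + 1) := by
    rintro ⟨n, rfl⟩
    rw [trivialZero_re] at h0
    have : (0 : ℝ) ≤ n := n.cast_nonneg
    linarith
  have hs1 : s ≠ 1 := by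
    intro hs; rw [hs] at h1; simp at h1
  have hre := hRH s hz hnt hs1
  rw [hre, sub_self, abs_zero] at hε'
  exact (lt_irrefl (0 : ℝ)) (hε.trans_le hε')

end Summit.RiemannHypothesis.RiemannHypothesis.Theorems.AsymptoticCriticalLine.Negative
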